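import Summits.BirchSwinnertonDyer.BirchSwinnertonDyer.Theorems.AdditiveBranchIMCGreenbergVatsalResidualBranchOfPrintOdd
import HarnessLib

/-!
# Item 19297 `GreenbergVatsalResidualBranch` BY NAME, CONDITIONALLY: the reading fact
# `thm312_branch_unitContent_and_lambda_eq_residual_goodOrd` is a KERNEL CONSEQUENCE of four
# verbatim-er typed Greenberg–Vatsal statements (route K1 `AdditiveBranchIMC`, crux ReadingFacts
# stmt-…-19361, child **19297**; seat `bsd-inputs-abimc-rf-p1`)

HONEST FRAMING (cell `bsd-addord`, `run/shared/lean/pub/bsd-addord/README.md` §4): KERNEL GLUE between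
named facts; THEOREMS ONLY (no `def`, no `sorry`); nothing is booked. This is a CONDITIONAL result: the
four hypotheses are unproved named facts of the tree (published theorems of Greenberg–Vatsal 2000
together with Ferrero–Washington / Mazur–Wiles), so the item is NOT closed by this file; what it shows
is that the READING hGV (GV Thm. (3.12) "+ (26)–(28) + pp. 41–43 + §2 p. 29 read on the
`ω^{(p−1)/2}`-branch with the residual groups of the additive twist", referee A pub-bsdpct R244.3 (ii))
carries NO content beyond
* T311χ = `thm311_quadraticTwist_hasUnitContent_iff_and_order_eq_of_lineRamifiedEven` (GV Thm. (3.11),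
  "any even character", at `χ = (·/p)`, `p ≡ 1 (mod 4)`; p396680),
* T312odd = `thm312_quadraticTwistOdd_hasUnitContent_iff_and_order_eq_of_lineRamifiedOdd` (GV
  Thm. (3.12) at the odd `χ = (·/p)`, `p ≡ 3 (mod 4)`),
* C = `characterLFunctionC_hasUnitContent_and_order_eq_card_of_ne_one`,
  D = `characterLFunctionD_hasUnitContent_and_order_eq_card_of_ne_teichmuller` (GV pp. 41–42 with
  §2 p. 29: Ferrero–Washington, Mazur–Wiles, Props. (2.6)/(2.8), at a twist),
plus kernel glue (`…OfPrint.lean` even sign, `…OfPrintOdd.lean` odd sign). BSD is not proved by any of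
this.

References: [GreenbergVatsal2000] §2 pp. 28–29, §3 Thm. (3.11), Thm. (3.12), (24), (26)–(28), pp. 39–45.
-/

set_option autoImplicit false
set_option linter.dupNamespace false

noncomputable section

open scoped Classical MatrixGroups ModularForm

namespace Summit.BirchSwinnertonDyer.BirchSwinnertonDyer.Theorems.AdditiveBranchIMCGreenbergVatsalResidualBranchOfPrintFull

open Literature.NumberTheory.EllipticCurves.GreenbergVatsal2000
  Summit.BirchSwinnertonDyer.BirchSwinnertonDyer.Theorems.AdditiveBranchIMCGreenbergVatsalResidualBranchOfPrint
  Summit.BirchSwinnertonDyer.BirchSwinnertonDyer.Theorems.AdditiveBranchIMCGreenbergVatsalResidualBranchOfPrintOdd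

/-- **The reading hGV = `thm312_branch_unitContent_and_lambda_eq_residual_goodOrd` (item 19297, the
conjunct `GreenbergVatsalResidualBranch` of the crux ReadingFacts BY NAME) from T311χ ∧ T312odd ∧ C ∧ D**
— CONDITIONAL on these four named facts (GV 2000 Thm. (3.11)/(3.12) at `χ = (·/p)` as typed, and the
two character sentences of pp. 41–42 at a twist): case split on `p mod 4` into the even-sign half
(`thm312_branch_of_thm311Twisted_of_characterFacts_of_mod_four_eq_one`) and the odd-sign half
(`thm312_branch_of_thm312TwistedOdd_of_characterFacts_of_mod_four_eq_three`).
[cite: GreenbergVatsal2000, §3 Thm. (3.11) p. 43, Thm. (3.12) p. 45, (26)–(28) pp. 41–42; §2 pp. 28–29] -/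
theorem thm312_branch_of_thm311Twisted_of_thm312TwistedOdd_of_characterFacts
    (h311 : thm311_quadraticTwist_hasUnitContent_iff_and_order_eq_of_lineRamifiedEven)
    (h312 : thm312_quadraticTwistOdd_hasUnitContent_iff_and_order_eq_of_lineRamifiedOdd)
    (hCfact : characterLFunctionC_hasUnitContent_and_order_eq_card_of_ne_one)
    (hDfact : characterLFunctionD_hasUnitContent_and_order_eq_card_of_ne_teichmuller) :
    thm312_branch_unitContent_and_lambda_eq_residual_goodOrd := by
  intro V _ _ W _ _ p _ K _ _ _ κ N _ f S₀ Φ₀ hΦ hp2 hgood hord hred h2 hθ hCW hκ hf heven hnt hram hS₀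
    hS ϖ hϖ b u hb
  have hpr : p.Prime := Fact.out
  have h4 : p % 4 = 1 ∨ p % 4 = 3 := by
    rcases hpr.eq_two_or_odd with h | h
    · exact absurd h hp2
    · omega
  rcases h4 with h4 | h4
  · exact thm312_branch_of_thm311Twisted_of_characterFacts_of_mod_four_eq_one h311 hCfact hDfact V W p
      K κ f S₀ Φ₀ hΦ hp2 h4 hgood hord hred h2 hθ hCW hκ hf heven hnt hram hS₀ hS ϖ hϖ b u hb
  · exact thm312_branch_of_thm312TwistedOdd_of_characterFacts_of_mod_four_eq_three h312 hCfact hDfact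
      V W p K κ f S₀ Φ₀ hΦ hp2 h4 hgood hord hred h2 hθ hCW hκ hf heven hnt hram hS₀ hS ϖ hϖ b u hb

end Summit.BirchSwinnertonDyer.BirchSwinnertonDyer.Theorems.AdditiveBranchIMCGreenbergVatsalResidualBranchOfPrintFull

end
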